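import Mathlib
import HarnessLib
import HarnessLib.Audit
import Summits.CriticalPhenomena.Statement
import Literature.Probability.Percolation.CardyFormula
import Literature.Probability.Percolation.QuadCrossingSpace
import HarnessLib.Audit.Status.Attr

/-!
Route: CardyMeckeFlip

# Route CardyMeckeFlip — percolation's Mecke identity — flip-invariance of the pivotal Campbell
measure plus exact duality and flip-ergodicity pin CLE₆; ℤ² limits satisfy it, Cardy and LimitExists
drop out

It suffices to show X = SublimitsCardy: every subsequential Schramm–Smirnov quad-crossing limit μ ∈
Λ = `subseqQuadLimits univ` of bond-ℤ²
percolation at p = ½ gives every quad of a conformal rectangle R its Cardy value F(η_R) (card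
percolation-mecke-flip-rigidity-2). X is reached
through the card's three cruxes, typed on the Schramm–Smirnov space ℋ_ℂ = `QuadConfig univ` with the
pivotal predicate Piv(S,x,Q) ("flipping at x
toggles Q": Q ∈ S and no sub-quad avoiding a ball around x is crossed, or Q ∉ S and crossed
sub-quads reach every ball around x from both
sides) written inline as a characterised parameter: K1 FlipIdentityZ2 (every μ ∈ Λ carries an
admissible pivotal kernel family M_ε — measurable
in S, isometry-equivariant, locally integrable, supported on pivotal points — whose Campbell measure
μ(dS)M_ε(S)(dx) is invariant under the
pivotal involution on cylinder test functions: the flip identity (F)), K3 FlipErgodicityZ2 (such an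
M exists with μ an extreme point of the
flip-fair laws for M: flip-ergodicity), K2 MeckeRigidity (an E(2)-invariant, exactly self-dual, RSW
law on ℋ_ℂ carrying an admissible flip-fair
kernel family for which it is extremal has Cardy crossing values), plus Z2LimitsSymmetric (μ ∈ Λ is
E(2)-invariant, self-dual, RSW) and the
support bridge LawToCrossings (X ⇒ subsequential convergence of `bondDomainCrossingProb`).
LimitExists and conformal invariance are OUTPUT.
Lean: `open Literature.Probability.Percolation.QuadCrossing in ∀ μ : MeasureTheory.FiniteMeasure
(QuadConfig (Set.univ : Set ℂ)), μ ∈ subseqQuadLimits (Set.univ : Set ℂ) → (∀ (R :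
Literature.Probability.RandomPlanarGeometry.ConformalRectangle) (φ :
Literature.Probability.RandomPlanarGeometry.ConformalEquiv UpperHalfPlane.upperHalfPlaneSet
R.carrier) (x : Fin 4 → ℝ), R.IsUniformizing φ x → ∀ Q : Quad (Set.univ : Set ℂ), Q.carrier =
closure R.carrier → Q.side 0 = R.arc 0 → Q.side 1 = R.arc 1 → Q.side 2 = R.arc 2 → Q.side 3 = R.arc
3 → (((μ : MeasureTheory.FiniteMeasure (QuadConfig (Set.univ : Set ℂ))) : MeasureTheory.Measure
(QuadConfig (Set.univ : Set ℂ)))).real (QuadConfig.crossedEvent Q) =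
Literature.Probability.RandomPlanarGeometry.cardyFunction
(Literature.Probability.RandomPlanarGeometry.crossRatio x))`

## Assembly
Pure logic plus the sequential characterisation of one-sided limits (PROVED sorry-free in the
planner's Sketch.lean / glue.lean, theorem
`closes`, axioms propext / Classical.choice / Quot.sound): for μ ∈ Λ, Z2LimitsSymmetric gives (prob,
E2, D, c, RSW), FlipErgodicityZ2 gives an
admissible flip-fair kernel family M with extremality, and MeckeRigidity — instantiated at Piv :=
its defining predicate, proof `Iff.rfl` —
returns the Cardy values: this is SublimitsCardy (X) — filed as the glue support item
CruxesToSublimitsCardy : MeckeRigidity →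
FlipErgodicityZ2 → Z2LimitsSymmetric → SublimitsCardy (rev 3, route-choice: the item that concludes
the target; provable now by those four
lines). LawToCrossings turns X into convergence along a subsequence of every mesh sequence;
`Filter.tendsto_of_subseq_tendsto` (𝓝[>] 0 is countably generated) gives `R.HasCrossingLimit
(bondDomainCrossingProb R) cardyFunction` for every
R, i.e. `_root_.CardyFormulaZ2`. FlipIdentityZ2 is the provable core of FlipErgodicityZ2 (K3 ⇒ K1)
and LatticeFlipIdentity its lattice anchor;
neither is a hypothesis of `closes`. RANKING (triage advice followed): FlipIdentityZ2 is rank 2 —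
the ℤ²-specific, provable-looking and most
informative step (it validates the whole encoding); FlipErgodicityZ2 rank 3 (GPS's open question);
MeckeRigidity rank 4 — hardest, not to be staffed
before a flip-dynamics coupling estimate exists; Z2LimitsSymmetric rank 5.

Rationale: WHY THIS LINE. Mechanism (card percolation-mecke-flip-rigidity-2): a product of fair coins has
exactly one exact integration by parts — invariance of
P(dω)·(pivotal counting measure)(de) under flipping ω at e (LatticeFlipIdentity, exact iff p = ½) —
and this Campbell–Mecke identity survives in the
black-noise scaling limit where the product structure dies: on site-𝕋 it is GPS's theorem that
continuum dynamical percolation is a reversible Markov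
process for CLE₆ (GarbanPeteSchramm2018 §11.1), built on the pivotal measure as a measurable
function of the quad-crossing configuration
(GarbanPeteSchramm2013Pivotal, whose §1 p.10 records that measurability, tightness and coupling all
survive for ℤ² subsequential limits). Imported
from point-process theory: the Mecke characterisation template (Mecke1967; LastPenrose2017 Thm 4.1;
Dello Schiavo–Lytvynov arXiv:1706.07602) — take
the identity as the AXIOM and prove rigidity: with E(2)-invariance (DKKMO2020Rotational), exact
self-duality (kills the flip-fair near-critical
family ω_λ) and flip-ergodicity (kills the mixture ½(P_λ+P_−λ); = GPS's open ergodicity question,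
§12.1 Remark) the law is CLE₆, so every ℤ²
sublimit is identified at once: no observable, no discrete holomorphicity, no symmetry-upgrade crux,
no LimitExists crux. Prior routes of the sub
classify sublimits by symmetry data (CardyRotToConf, CardyScaleErgodic), measure class
(CardyBlackNoise), H¹-rigidity (CardyLocalRigidity) or a
Gaussian transform (CardyMagicRigidity); none uses the pivotal involution, and the negatives index
(NegDegenerateArcs, DualCurrent template) is untouched.

RANKED CRUXES. #0 SublimitsCardy (target) — every subsequential quad-crossing scaling limit μ of
bond-ℤ² percolation at p = ½ on ℋ_ℂ (μ ∈ subseqQuadLimits univ) assigns to every quad Q representing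
a conformal rectangle R (carrier = closure Ω, sides = the four arcs) the probability F(crossRatio x)
for every uniformizing datum (φ, x) of R — identification of ALL sublimits at the level of crossing
values; LimitExists and conformal invariance are consequences, not hypotheses. (why it might fail:
It is universality-for-ℤ² at crossing level (Schramm2007ICM Problem 2.11 along subsequences); false
iff some subsequential regime of bond-ℤ² is non-Cardy (LPSA numerics agree with F to 5e-3,
arXiv:math/9401222).) [SchrammSmirnov2011, Smirnov2001, Schramm2007ICM, arXiv:math/9401222]
#2 FlipIdentityZ2 (crux) — FLIP IDENTITY ON ℤ² (card K1, the construction statement): every μ ∈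
subseqQuadLimits univ carries a kernel family M with (ADM) and the flip identity (F) for every
cutoff ε > 0 — intended M_ε = subsequential limit, jointly with the configuration, of the
ε-important pivotal-edge counting measures normalised by δ²/π₄^{ℤ²}(δ,1), averaged over
rotations/reflections/shifts of the ε-grid (GPS's averaging trick) to make it isometry-equivariant;
(F) is the limit of the EXACT lattice identity LatticeFlipIdentity. [difficulty: XL] (why it might
fail: ω-measurability of the limit kernel and passage of (F) to the limit need GPS's
ratio-limit/coupling technology on ℤ² along a subsequence (claimed GPS13 §1 p.10, never written);
the inline predicate Piv must match lattice pivotality a.s. in the limit.)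
[GarbanPeteSchramm2013Pivotal, GarbanPeteSchramm2018, SchrammSmirnov2011, KestenScalingCMP1987,
Nolin2008]
#3 FlipErgodicityZ2 (crux) — FLIP-ERGODICITY OF ℤ² SUBLIMITS (card K3): every μ ∈ subseqQuadLimits
univ carries an admissible flip-fair kernel family M (as in FlipIdentityZ2) for which μ is an
extreme point (midpoint form) of the convex set of probability laws on ℋ_ℂ that are flip-fair for
every M_ε — equivalently no bounded non-constant density is invariant under pivotal flips, i.e. the
continuum dynamical percolation started from μ is ergodic. This is the axiom that alone excludes the
self-dual flip-fair mixture ½(P_λ + P_−λ) of near-critical limits (triage addition), so it is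
load-bearing. [deps: FlipIdentityZ2] [difficulty: open-problem] (why it might fail: Ergodicity of
continuum dynamical percolation is OPEN even for CLE₆ on 𝕋 (GarbanPeteSchramm2018 §12.1 Remark:
needs noise sensitivity of NON-monotone events such as ⊞_Q₁ ∩ ⊞_Q₂ᶜ); a ℤ² sublimit could carry a
flip-invariant macroscopic variable.) [GarbanPeteSchramm2018, GarbanPeteSchramm2010,
BenjaminiKalaiSchramm1999, SchrammSteif2010, SchrammSmirnov2011]
#4 MeckeRigidity (crux) — MECKE RIGIDITY (card K2, conclusion on the LAW's crossing values only, per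
triage flag): let P be a probability law on ℋ_ℂ = QuadConfig univ and M : ℝ → ℋ_ℂ → Measure ℂ a
kernel family (cutoff ε ↦ M_ε) such that (E2) P is invariant under every isometry of ℂ; (D) P is
exactly self-dual on finite-dimensional crossing marginals (law of (Q_i ∈ S)_i = law of (Q_iᵗ ∉
S)_i, Q_iᵗ the transposed quads); (RSW) every quad whose carrier is an axis-parallel 3:1 rectangle
with sides 0/2 its short edges has crossing probability ≥ c > 0; (ADM) each M_ε is measurable in S,
monotone in ε, locally P-integrable, supported on pivotal points, non-zero, isometry-equivariant;
(F) for every ε > 0 the Campbell measure P(dS)M_ε(S)(dx) is invariant under the pivotal involution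
on cylinder test functions φ(x)·g({i | Q_i ∈ S}) ↦ φ(x)·g({i | Q_i ∈ S} Δ {i | Piv S x Q_i}); (EXT)
P is a midpoint-extreme point of the convex set of probability laws flip-fair for every M_ε (=
flip-ergodicity). THEN every quad of a conformal rectangle has P-probability F(cross-ratio).
[difficulty: open-problem] (why it might fail: Contains universality (critical Voronoi / any
self-dual isotropic lattice limit meets every hypothesis given K1/K3-type inputs) and an exotic
self-dual flip-fair flip-ergodic E(2)-law on ℋ may exist; the uniqueness-of-stationary-law proof
needs a flip-dynamics coupling nobody has.) [GarbanPeteSchramm2018, GarbanPeteSchramm2013Pivotal,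
SchrammSmirnov2011, LastPenrose2017, arXiv:1706.07602, Tsirelson2003, CamiaNewman2006]
#5 Z2LimitsSymmetric (crux) — SYMMETRIES OF ℤ² SUBLIMITS (the non-flip hypotheses of MeckeRigidity):
every μ ∈ subseqQuadLimits univ is a probability law, invariant under every isometry of ℂ
(translations: lattice + continuity; rotations: DKKMO; reflections: lattice), exactly self-dual on
finite-dimensional crossing marginals (lattice duality at p = ½ + null boundary events), and
satisfies the 3:1 RSW lower bound with some c > 0 (rsw_half + null frontier). [difficulty: L] (why
it might fail: Joint rotation invariance of the LAW on ℋ needs DKKMO's loop theorem + loops→quads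
measurability (in tree only the per-quad fact dkkmo_crossing_rotation_invariance, unproved); exact
self-duality for ALL quads needs null frontier of every fixed quad (SS11 Cor 5.2, ℤ² 3-arm inputs).)
[DKKMO2020Rotational, SchrammSmirnov2011, GarbanPeteSchramm2013Pivotal, GrimmettPercolation1999,
Tassion2016]
#9 LawToCrossings (support) — BRIDGE (card P2): SublimitsCardy ⇒ for every mesh sequence u_k → 0⁺
there is a subsequence ψ along which bondDomainCrossingProb R (u (ψ k)) → F(crossRatio x) for every
conformal rectangle R and uniformizing datum. Proof path: SchrammSmirnov2011_thm_1_4_holds (compact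
metrisable ℋ_ℂ, PROVED in tree) + Prokhorov extract μ ∈ Λ along a sub-subsequence of z2QuadLaw univ
(u (ψ k)); null frontier of ⊞_Q under percolation sublimits (SS11 Cor 5.2; QuadCrossingNullFrontier)
+ portmanteau give convergence of μ_δ(⊞_Q); quadCrossing_subset_setOf_mem_z2QuadConfig /
setOf_mem_z2QuadConfig_subset_quadCrossing pass to the continuum-arc event 𝒞_δ(R); boundary RSW
passes to G02's discrete-arc event (content of the shared DiscretisationBridge
stmt-CriticalPhenomena-0787). [difficulty: L] [SchrammSmirnov2011, GarbanPeteSchramm2013Pivotal,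
GrimmettPercolation1999, Smirnov2001]
#9 LatticeFlipIdentity (support) — THE EXACT LATTICE MECKE IDENTITY (card P1, provable now): for
bond percolation on δℤ² at p = ½, every finite set E of lattice edges, every finite family of quads
Q_i and every bounded measurable h(ω, e): Σ_{e∈E} E[1{e pivotal for some Q_i}·h(ω^e, e)] = Σ_{e∈E}
E[1{e pivotal for some Q_i}·h(ω, e)], where ω^e = ω Δ {e} and "pivotal" = the crossing status of Q_i
in z2QuadConfig differs between ω and ω^e. Proof: ω ↦ ω Δ {e} preserves P_½ for a genuine edge e and
pivotality of e is symmetric under it. (At general p the defect is (1−2p)·Σ_e E[1{piv}·h·(1{e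
open}/p − 1{e closed}/(1−p))]: the identity characterises p = ½.) [difficulty: provable-now]
[GrimmettPercolation1999, GarbanPeteSchramm2018, Mecke1967]
#9 CruxesToSublimitsCardy (support, glue; rev 3, route-choice 2026-08-16) — TARGET REACHABILITY:
MeckeRigidity → FlipErgodicityZ2 → Z2LimitsSymmetric → SublimitsCardy. Pure logic, provable now: for
μ ∈ Λ take (prob, E2, D, c, RSW) from Z2LimitsSymmetric, the admissible flip-fair extremal kernel
family M from FlipErgodicityZ2 at Piv := its defining predicate (Iff.rfl), and apply MeckeRigidity
at the same Piv to (μ, M) — literally the first `have` of `closes` (planner Sketch.lean: 4-line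
term, lean rc 0, axioms propext/Classical.choice/Quot.sound). It is the item that concludes the
target, so the item graph reads cruxes →(CruxesToSublimitsCardy) SublimitsCardy →(LawToCrossings,
closes) CardyFormulaZ2. [deps: MeckeRigidity, FlipErgodicityZ2, Z2LimitsSymmetric] [difficulty:
provable-now]

TWO-LAYER PLAN. Foreseen glued splits (filed only after a crux closes or a definition lands; k ≤ 3,
depth 1): FlipErgodicityZ2 ⇐ FlipIdentityZ2 →
PivotalKernelErgodic → FlipErgodicityZ2 once D2 names the canonical kernel (PivotalKernelErgodic =
"μ is extremal for THE GPS kernel", proof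
path: noise sensitivity of ℤ² crossings (GarbanPeteSchramm2010 covers bond-ℤ²) ⇒ mixing of the
stationary flip dynamics ⇒ triviality of
flip-invariant densities, the non-monotone step being the open part). MeckeRigidity ⇐
StationaryUniqueness → CLE6IsCardy → MeckeRigidity
(StationaryUniqueness: two extremal flip-fair self-dual E(2) RSW laws with equivariant kernels
coincide — coupling through shared Poisson clocks on
the common part of the kernels; CLE6IsCardy: the identified law has Cardy values = Smirnov2001 +
CamiaNewman2006 through
hasCrossingLimit_triDomainCrossingProb). FlipIdentityZ2 ⇐ KernelExistsZ2 (GPS13 §4–5 on ℤ² along the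
subsequence: tightness, ratio limits,
measurability) → FlipPassesToLimit (GPS18 §6–9 coupling: (F) survives) → FlipIdentityZ2.
Z2LimitsSymmetric ⇐ JointRotationInvariance →
SelfDualMarginals → Z2LimitsSymmetric.

KILL CRITERIA. ¬MeckeRigidity by an explicit exotic law (E(2)-invariant, exactly self-dual, RSW,
flip-fair, flip-ERGODIC, non-Cardy) closes the route
`refuted:MeckeRigidity` — and is itself a major result (a second critical-percolation-like
universality class or a proof that the axioms miss
one). ¬MeckeRigidity by a law violating only the SPIRIT of an axiom through the inline encoding
(e.g. a kernel charging non-pivotal points that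
the predicate Piv misclassifies, or junk from non-measurable sections) is class `misstated`: repair
by a restated item (countable dense quad
family inside Piv, or the named notions of D1/D2), not a close. ¬FlipErgodicityZ2 for a genuine ℤ²
sublimit (a flip-invariant macroscopic
variable) kills the mechanism outright: close refuted. ¬FlipIdentityZ2 because (F) fails in the
limit for the canonical kernel would contradict
GPS18 §11.1 on 𝕋 and signals a misstatement (restate); because no ω-measurable kernel exists along
ℤ² subsequences (GPS13's p.10 claim wrong) ⇒
pivot to the joint-law version (kernel as extra randomness, (F) for the pair) with a weakened
rigidity crux, or retire. ¬Z2LimitsSymmetric can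
only come from the self-duality clause for wild quads ⇒ restate with piecewise-smooth quads.
CardyFormulaZ2, CardyUniqueLimitThesis or
CardyBlackNoise.SubseqConformalInvariance + SubseqCardyRigidity proved elsewhere moot the route;
CardyRigidity (stmt-CriticalPhenomena-0746) proved
elsewhere shortens CLE6IsCardy.

NOT DECOMPOSED YET. The interior of MeckeRigidity (stationary-law uniqueness for the flip dynamics;
which axiom is used where) — deliberately one node until a
prover proposes the coupling; the canonical kernel as a NAMED notion (definition requests D1/D2
below: until they land the pivotal predicate and
flip-fairness are inline characterised parameters, identical text in K1–K3 so that `closes` chains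
them syntactically); the p-defect identity
and the FK(p_sd(q), q) flip cocycle q^{∓1/2} (card P1 extras: the computations showing (F)
characterises q = 1, p = ½ — evidence, not items); the
near-critical falsifier family ω_λ (flip-fair, not self-dual) and the mixture ½(P_λ+P_−λ)
(self-dual, flip-fair, not ergodic) as Lean
counterexamples to axiom-dropped variants of K2 (refuter work, would certify that (D) and (EXT) are
each necessary); measurability of the
(S, x)-sections of Piv (analytic, hence universally measurable — enough for the Bochner integrals as
typed); boundary regularity for wild Jordan
quads (shared with CardyUniqueLimit / CardyBlackNoise).

CHEAPEST FALSIFIER. (i) Drop-one-axiom sanity against the EXACT typed clauses: (D) must fail for the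
near-critical limits P_λ (it reads P_λ = P_−λ on
one-rectangle marginals; long-rectangle crossing probabilities are monotone in λ, GPS18 §1) and
(EXT) must fail for ½(P_λ+P_−λ) (P_±λ are
flip-fair for the same kernel recipe: lattice defect (1−2p)·O(1) = O(λ·w(δ)) → 0) — done by hand
(card author, triage refuter, this planner);
a refuter should redo it in the transpose convention and midpoint form as typed. (ii) Degenerate-law
audit of MeckeRigidity: δ_all, δ_none,
½(δ_all+δ_none), fixed-scale Voronoi colouring — each violates a typed hypothesis ((D); (D);
non-zero kernel, since Piv ≡ ∅ and the support
clause force M = 0; same) — checked by hand. (iii) Lookup: any printed uniqueness of the reversible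
law of continuum dynamical percolation or
Mecke-type characterisation of CLE₆? Searched (§ Novelty): none. (iv) LatticeFlipIdentity is
provable now; if its typed form FAILS in Lean
(non-edge flips, measurability of z2QuadConfig events) the encoding is wrong everywhere — the
cheapest Lean check, run it first.

NUMBERS. p_c(ℤ² bond) = ½ (Kesten 1980); flip defect at density p: (1−2p)·Σ_e E[1{piv}·h·(1{open}/p
− 1{closed}/(1−p))], zero iff p = ½; FK(p_sd(q), q)
pivotal flip cocycle q^{∓1/2} (GrimmettRandomCluster2006 Thm 3.1), = 1 iff q = 1; near-critical
window p = ½ + λ·w(δ), w(δ) = δ²/π₄(δ,1) → 0, so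
the normalised defect is O(λ·w(δ)) → 0 (ω_λ flip-fair) while P_λ ≠ P_−λ on a 3:1 rectangle for λ ≠
0; expected number of ε-important points in a
unit quad ≍ δ⁻²π₄(δ,1) (GPS13 §1), = δ^{−3/4+o(1)} on 𝕋, δ^{−2+α₄} with α₄ ∈ (1, 2) unknown on ℤ²
(no exponent VALUE is used anywhere); RSW
constant c for 3:1 hard crossings on ℤ² at p = ½: any c ≤ liminf works (Grimmett 1999 §11.7). Items
at open: 8 (1 target, 4 cruxes, 2 support,
1 assembly); rev 3 adds the glue support CruxesToSublimitsCardy: 9 (1 target, 4 cruxes, 3 support, 1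
assembly).

DEFINITION REQUESTS. D1 `QuadConfig.IsPivotalAt` / `QuadConfig.flipAt` (topic
Literature/Probability/Percolation; source GarbanPeteSchramm2013Pivotal §2.2–2.4,
GarbanPeteSchramm2018 §2–3): the pivotal predicate Piv(S, x, Q) on ℋ_D exactly as inlined in the
items (open-pivotal ∨ closed-pivotal through
sub-quads), its measurability lemmas, and the flipped configuration S^x ∈ ℋ_D (closure of the
toggled quad set) with (S^x)^x = S a.s. for
percolation limits. D2 `IsFlipFairKernel` / `pivotalKernel` (same topic): a kernel family M : ℝ →
ℋ_D → Measure ℂ, the Campbell measure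
P(dS)M_ε(S)(dx), flip-fairness (F) and midpoint-extremality as named Props, and — for D = ℂ and μ ∈
subseqQuadLimits — GPS's normalised
ε-important counting measures whose subsequential limits are the intended witnesses of
FlipIdentityZ2. Wanted for: restating K1–K3 by name
(shorter signatures, shared across routes) and for the foreseen split child PivotalKernelErgodic.
Cite facts wanted (family crit-ising):
GarbanPeteSchramm2018 §11.1 Thm (dynamical limit on 𝕋 is Markov and reversible w.r.t. the CLE₆
quad-crossing law); GarbanPeteSchramm2013Pivotal
Thm 1.1/§4 (pivotal measure measurable w.r.t. ω, 𝕋) with its §1 p.10 ℤ²-subsequential remark;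
SchrammSmirnov2011 Cor 5.2 (null frontier of ⊞_Q
for sublimits).

Novelty: Searches (2026-08-15, this seat, on top of the card's five): `lit search --hybrid "flip invariance
pivotal measure characterization CLE6
stationary law dynamical percolation"` (12 book rows, vector leg only — Grimmett, Liggett IPS,
Lawler; nothing on characterising percolation
limits by flip-stationarity); `lit search --source arxiv "noise sensitivity non-monotone events
critical percolation dynamical ergodic"` (0);
`lit search --source all "noise sensitivity percolation non-monotone" --year-from 2015` (rc 75,
searchd down); `lit galaxy search "dynamical
percolation" --star all` (51 rows: network-science books; pdf: Köhler-Schindler–Tassion RSW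
arXiv:2011.04618, Ahlberg–Broman–Griffiths–Morris
noise sensitivity in continuum percolation, DC–Manolescu–Tassion fractal properties — none on
stationary-law uniqueness); `lit galaxy search
"pivotal measure" --star pdf` (20 rows, all off-topic); `lit read arXiv:1008.1378 --grep
"Z\^2|subsequential|ratio limit"` (26 hits; §1 p.10
read: ℤ² subsequential validity of measurability/tightness/coupling); `lit read arXiv:1305.5526
--grep "reversib|stationar|ergodic"` (38 hits;
§11.1 Thm reversible Markov, §12.1 Remark ergodicity open, read); `ledger negatives --problem
CriticalPhenomena` (6, none touched); the 53 route
files of the sub grepped by header (no route uses pivotal flips / Mecke / stationary-law uniqueness;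
CardyFlipRusso's "flips" are Delaunay
flips of an embedded lattice, a transport line).
Nearest prior art found: GarbanPeteSchr  [refs: 2011.04618, 1008.1378, 1305.5526, 1706.07602, GarbanPeteSchramm2018, LastPenrose2017, Mecke1967]

Barriers (technique_class: axiomatic-rigidity, campbell-mecke-identity, pivotal-flips): - technique_class: axiomatic-rigidity, campbell-mecke-identity, pivotal-flips
- Literature.Barriers.CriticalPhenomena.EmbeddingModulusUniqueness: evaded — nothing here is
embedding-blind: MeckeRigidity carries invariance under ALL isometries of ℂ as hypothesis (E2)
(false for a sheared lattice φ_β(ℤ²), whose sublimits are flip-fair and self-dual but not rotation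
invariant — exactly Beffara's second modulus), and Z2LimitsSymmetric imports the embedding-specific
input DKKMO2020Rotational; (F) itself IS embedding-blind (it holds on every lattice at its self-dual
point), which is why (E2) and (D) must sit in K2 and why K2 honestly contains isotropic
universality.
- Literature.Barriers.CriticalPhenomena.SmirnovTriangularOnly: not in its class — no discrete
harmonic triple, no colour switching, no 2π/3-Cauchy–Riemann; Smirnov2001/CamiaNewman2006 enter only
inside MeckeRigidity's identification tail (the identified law has Cardy values), as in every route
of the sub.
- Literature.Barriers.CriticalPhenomena.FKParafermionicHalfCauchyRiemann: not in its class — no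
vertex/parafermionic observable, no boundary-value problem; the FK family appears only as a
falsifier certificate (flip cocycle q^{∓1/2} ≠ 1 for q ≠ 1).
- Literature.Barriers.CriticalPhenomena.CoveringLatticeShift: not in its class — no mixed site/bond
interpolation, no Russo pairing along a path in p or q; the flip identity is used AT p = ½ as an
invariance, never differentiated.
- Literature.Barriers.CriticalPhenomena.Scale

Novelty grade: new-combination — g44-38. PRIOR ART: GPS2013 arXiv:1008.1378 = pivotal measure behind K1; GPS2018 arXiv:1305.5526 11.1 = flip dynamics FROM CLE6, reversible (T-instance of (F)), 12.1 ergodicity open (K3's status); Mecke1967 / LastPenrose2017 Thm 4.1 / arXiv:1706.07602 = characterisation-by-Campbell-measure-invariance (refuter refuter-refute-pool-g44-38, 2026-08-15T19:54:44Z; prior: arXiv:1008.1378, arXiv:1305.5526, Mecke1967, LastPenrose2017, arXiv:1706.07602, SchrammSmirnov2011, DKKMO2020)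

History (route lifecycle, newest last):
- 2026-08-15T20:08:13Z · rev 2: restated LatticeFlipIdentity (stmt-CriticalPhenomena-14829) — route-repair (cone guardrail; unit rrepair-CriticalPhenomena-CardyMeckeFl-cc7ec255, gen 1, planner): needs-fact: none. REROUTED: imports [CardyFormula, QuadCros (planner-rrepair-CriticalPhenomena-CardyMeckeFl-cc7ec255-0)

sub-problem: CardyFormulaZ2 · status: open · opened planner-plancard-CriticalPhenomena-CardyFormu-27bbc148-0 2026-08-15T19:12:57Z · rev 4 · ledger route-CriticalPhenomena-CardyMeckeFlip
GENERATED by the gate from the ledger (D-0016/17). Provers cite these decls: `theorem foo : Summit.CriticalPhenomena.CardyFormulaZ2.Theses.CardyMeckeFlip.<Decl> := …` in Summits/CriticalPhenomena/CardyFormulaZ2/Theorems/<Name>.lean.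
-/

namespace Summit.CriticalPhenomena.CardyFormulaZ2.Theses.CardyMeckeFlip

open scoped BigOperators Topology Manifold Classical MeasureTheory ProbabilityTheory Matrix InnerProductSpace ComplexConjugate ContinuousMap
open Filter Set Function TopologicalSpace MeasureTheory

attribute [summit_statement] _root_.CardyFormulaZ2

/-- item stmt-CriticalPhenomena-14823 · target · rank 0 · open · by planner
why it might fail: It is universality-for-ℤ² at crossing level (Schramm2007ICM Problem 2.11 along subsequences); false iff some subsequential regime of bond-ℤ² is non-Cardy (LPSA numerics agree with F to 5e-3, arXiv:math/9401222).
sources: SchrammSmirnov2011, Smirnov2001, Schramm2007ICM, arXiv:math/9401222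
[target] every subsequential quad-crossing scaling limit μ of bond-ℤ² percolation at p = ½ on ℋ_ℂ (μ
∈ subseqQuadLimits univ) assigns to every quad Q representing a conformal rectangle R (carrier =
closure Ω, sides = the four arcs) the probability F(crossRatio x) for every uniformizing datum (φ,
x) of R — identification of ALL sublimits at the level of crossing values; LimitExists and conformal
invariance are consequences, not hypotheses. -/
@[route_item "route-CriticalPhenomena-CardyMeckeFlip"]
def SublimitsCardy : Prop :=
  open Literature.Probability.Percolation.QuadCrossing in ∀ μ : MeasureTheory.FiniteMeasure (QuadConfig (Set.univ : Set ℂ)), μ ∈ subseqQuadLimits (Set.univ : Set ℂ) → (∀ (R : Literature.Probability.RandomPlanarGeometry.ConformalRectangle) (φ : Literature.Probability.RandomPlanarGeometry.ConformalEquiv UpperHalfPlane.upperHalfPlaneSet R.carrier) (x : Fin 4 → ℝ), R.IsUniformizing φ x → ∀ Q : Quad (Set.univ : Set ℂ), Q.carrier = closure R.carrier → Q.side 0 = R.arc 0 → Q.side 1 = R.arc 1 → Q.side 2 = R.arc 2 → Q.side 3 = R.arc 3 → (((μ : MeasureTheory.FiniteMeasure (QuadConfig (Set.univ : Set ℂ)))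 : MeasureTheory.Measure (QuadConfig (Set.univ : Set ℂ)))).real (QuadConfig.crossedEvent Q) = Literature.Probability.RandomPlanarGeometry.cardyFunction (Literature.Probability.RandomPlanarGeometry.crossRatio x))

/-- item stmt-CriticalPhenomena-14824 · crux · rank 2 · open · by planner
why it might fail: ω-measurability of the limit kernel and passage of (F) to the limit need GPS's ratio-limit/coupling technology on ℤ² along a subsequence (claimed GPS13 §1 p.10, never written); the inline predicate Piv must match lattice pivotality a.s. in the limit.
sources: GarbanPeteSchramm2013Pivotal, GarbanPeteSchramm2018, SchrammSmirnov2011, KestenScalingCMP1987, Nolin2008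
[crux] FLIP IDENTITY ON ℤ² (card K1, the construction statement): every μ ∈ subseqQuadLimits univ
carries a kernel family M with (ADM) and the flip identity (F) for every cutoff ε > 0 — intended M_ε
= subsequential limit, jointly with the configuration, of the ε-important pivotal-edge counting
measures normalised by δ²/π₄^{ℤ²}(δ,1), averaged over rotations/reflections/shifts of the ε-grid
(GPS's averaging trick) to make it isometry-equivariant; (F) is the limit of the EXACT lattice
identity LatticeFlipIdentity. [difficulty: XL] -/
@[route_item "route-CriticalPhenomena-CardyMeckeFlip"]
def FlipIdentityZ2 : Prop :=
  open Literature.Probability.Percolation.QuadCrossing in ∀ (Piv : QuadConfig (Set.univ : Set ℂ) → ℂ → Quad (Set.univ : Set ℂ) → Prop), (∀ (S : QuadConfig (Set.univ : Set ℂ)) (x : ℂ) (Q : Quad (Set.univ : Set ℂ)), Piv S x Q ↔ ((Q ∈ S ∧ ∀ ε : ℝ, 0 < ε → ∀ Q' : Quad (Set.univ : Set ℂ), Q'.carrier ⊆ Q.carrier \ Metric.ball x ε → Q'.side 0 ⊆ Q.side 0 → Q'.side 2 ⊆ Q.side 2 → Q' ∉ S) ∨ (Q ∉ S ∧ ∀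 ε : ℝ, 0 < ε → ∃ Q₁ Q₂ : Quad (Set.univ : Set ℂ), Q₁ ∈ S ∧ Q₂ ∈ S ∧ Q₁.carrier ⊆ Q.carrier ∧ Q₂.carrier ⊆ Q.carrier ∧ Q₁.side 0 ⊆ Q.side 0 ∧ Q₁.side 2 ⊆ Metric.ball x ε ∧ Q₂.side 0 ⊆ Metric.ball x ε ∧ Q₂.side 2 ⊆ Q.side 2))) → ∀ μ : MeasureTheory.FiniteMeasure (QuadConfig (Set.univ : Set ℂ)), μ ∈ subseqQuadLimits (Set.univ : Set ℂ) → ∃ M : ℝ → QuadConfig (Set.univ : Set ℂ) → MeasureTheory.Measure ℂ, ((∀ ε : ℝ, Measurable (M ε)) ∧ (∀ ε ε' : ℝ, 0 < ε' → ε' ≤ ε → ∀ S : QuadConfig (Set.univ : Set ℂ), M ε S ≤ M ε' S) ∧ (∀ ε : ℝ, 0 < ε → ∀ r : ℝ, ∫⁻ S, M ε S (Metric.closedBall 0 r) ∂(((μ : MeasureTheory.FiniteMeasure (QuadConfig (Set.univ : Set ℂ))) : MeasureTheory.Measure (QuadConfig (Set.univ : Set ℂ)))) < ⊤) ∧ (∀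 ε : ℝ, 0 < ε → ∀ᵐ S ∂(((μ : MeasureTheory.FiniteMeasure (QuadConfig (Set.univ : Set ℂ))) : MeasureTheory.Measure (QuadConfig (Set.univ : Set ℂ)))), M ε S {x | ¬ ∃ Q : Quad (Set.univ : Set ℂ), Piv S x Q} = 0) ∧ (∃ ε : ℝ, 0 < ε ∧ 0 < ∫⁻ S, M ε S (Metric.ball 0 1) ∂(((μ : MeasureTheory.FiniteMeasure (QuadConfig (Set.univ : Set ℂ))) : MeasureTheory.Measure (QuadConfig (Set.univ : Set ℂ))))) ∧ (∀ (g : ℂ ≃ᵢ ℂ) (ε : ℝ) (S : QuadConfig (Set.univ : Set ℂ)), M ε (QuadConfig.isometry g S) = MeasureTheory.Measure.map g (M ε S))) ∧ (∀ ε : ℝ, 0 < ε → (∀ (n : ℕ) (Q : Fin n → Quad (Set.univ : Set ℂ)) (g : Set (Fin n) → ℝ) (φ : ℂ → ℝ), Continuous φ → HasCompactSupport φ → ∫ S, ∫ x, φ x * g {i | Q i ∈ S} ∂(M ε S) ∂(((μ : MeasureTheory.FiniteMeasure (QuadConfig (Set.univ : Set ℂ))) : MeasureTheory.Measure (QuadConfig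 (Set.univ : Set ℂ)))) = ∫ S, ∫ x, φ x * g {i | Xor (Q i ∈ S) (Piv S x (Q i))} ∂(M ε S) ∂(((μ : MeasureTheory.FiniteMeasure (QuadConfig (Set.univ : Set ℂ))) : MeasureTheory.Measure (QuadConfig (Set.univ : Set ℂ))))))

/-- item stmt-CriticalPhenomena-14825 · crux · rank 3 · open · by planner
why it might fail: Ergodicity of continuum dynamical percolation is OPEN even for CLE₆ on 𝕋 (GarbanPeteSchramm2018 §12.1 Remark: needs noise sensitivity of NON-monotone events such as ⊞_Q₁ ∩ ⊞_Q₂ᶜ); a ℤ² sublimit could carry a flip-invariant macroscopic variable.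
sources: GarbanPeteSchramm2018, GarbanPeteSchramm2010, BenjaminiKalaiSchramm1999, SchrammSteif2010, SchrammSmirnov2011
[crux] FLIP-ERGODICITY OF ℤ² SUBLIMITS (card K3): every μ ∈ subseqQuadLimits univ carries an
admissible flip-fair kernel family M (as in FlipIdentityZ2) for which μ is an extreme point
(midpoint form) of the convex set of probability laws on ℋ_ℂ that are flip-fair for every M_ε —
equivalently no bounded non-constant density is invariant under pivotal flips, i.e. the continuum
dynamical percolation started from μ is ergodic. This is the axiom that alone excludes the self-dual
flip-fair mixture ½(P_λ + P_−λ) of near-critical limits (triage addition), so it is load-bearing.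
[deps: FlipIdentityZ2] [difficulty: open-problem] -/
@[route_item "route-CriticalPhenomena-CardyMeckeFlip", crux]
def FlipErgodicityZ2 : Prop :=
  open Literature.Probability.Percolation.QuadCrossing in ∀ (Piv : QuadConfig (Set.univ : Set ℂ) → ℂ → Quad (Set.univ : Set ℂ) → Prop), (∀ (S : QuadConfig (Set.univ : Set ℂ)) (x : ℂ) (Q : Quad (Set.univ : Set ℂ)), Piv S x Q ↔ ((Q ∈ S ∧ ∀ ε : ℝ, 0 < ε → ∀ Q' : Quad (Set.univ : Set ℂ), Q'.carrier ⊆ Q.carrier \ Metric.ball x ε → Q'.side 0 ⊆ Q.side 0 → Q'.side 2 ⊆ Q.side 2 → Q' ∉ S) ∨ (Q ∉ S ∧ ∀ ε : ℝ, 0 < ε → ∃ Q₁ Q₂ : Quad (Set.univ : Set ℂ), Q₁ ∈ S ∧ Q₂ ∈ S ∧ Q₁.carrier ⊆ Q.carrier ∧ Q₂.carrier ⊆ Q.carrier ∧ Q₁.side 0 ⊆ Q.side 0 ∧ Q₁.side 2 ⊆ Metric.ball x ε ∧ Q₂.side 0 ⊆ Metric.ball x ε ∧ Q₂.side 2 ⊆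 Q.side 2))) → ∀ μ : MeasureTheory.FiniteMeasure (QuadConfig (Set.univ : Set ℂ)), μ ∈ subseqQuadLimits (Set.univ : Set ℂ) → ∃ M : ℝ → QuadConfig (Set.univ : Set ℂ) → MeasureTheory.Measure ℂ, ((∀ ε : ℝ, Measurable (M ε)) ∧ (∀ ε ε' : ℝ, 0 < ε' → ε' ≤ ε → ∀ S : QuadConfig (Set.univ : Set ℂ), M ε S ≤ M ε' S) ∧ (∀ ε : ℝ, 0 < ε → ∀ r : ℝ, ∫⁻ S, M ε S (Metric.closedBall 0 r) ∂(((μ : MeasureTheory.FiniteMeasure (QuadConfig (Set.univ : Set ℂ))) : MeasureTheory.Measure (QuadConfig (Set.univ : Set ℂ)))) < ⊤) ∧ (∀ ε : ℝ, 0 < ε → ∀ᵐ S ∂(((μ : MeasureTheory.FiniteMeasure (QuadConfig (Set.univ : Set ℂ))) : MeasureTheory.Measure (QuadConfig (Set.univ : Set ℂ)))), M ε S {x | ¬ ∃ Q : Quad (Set.univ : Set ℂ), Piv S x Q} = 0) ∧ (∃ ε : ℝ, 0 < ε ∧ 0 < ∫⁻ S, M ε S (Metric.ball 0 1) ∂(((μ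 : MeasureTheory.FiniteMeasure (QuadConfig (Set.univ : Set ℂ))) : MeasureTheory.Measure (QuadConfig (Set.univ : Set ℂ))))) ∧ (∀ (g : ℂ ≃ᵢ ℂ) (ε : ℝ) (S : QuadConfig (Set.univ : Set ℂ)), M ε (QuadConfig.isometry g S) = MeasureTheory.Measure.map g (M ε S))) ∧ (∀ ε : ℝ, 0 < ε → (∀ (n : ℕ) (Q : Fin n → Quad (Set.univ : Set ℂ)) (g : Set (Fin n) → ℝ) (φ : ℂ → ℝ), Continuous φ → HasCompactSupport φ → ∫ S, ∫ x, φ x * g {i | Q i ∈ S} ∂(M ε S) ∂(((μ : MeasureTheory.FiniteMeasure (QuadConfig (Set.univ : Set ℂ))) : MeasureTheory.Measure (QuadConfig (Set.univ : Set ℂ)))) = ∫ S, ∫ x, φ x * g {i | Xor (Q i ∈ S) (Piv S x (Q i))} ∂(M ε S) ∂(((μ : MeasureTheory.FiniteMeasure (QuadConfig (Set.univ : Set ℂ))) : MeasureTheory.Measure (QuadConfig (Set.univ : Set ℂ)))))) ∧ (∀ P₁ P₂ : MeasureTheory.Measure (QuadConfig (Set.univ : Set ℂ)), MeasureTheory.IsProbabilityMeasure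 P₁ → MeasureTheory.IsProbabilityMeasure P₂ → (∀ ε : ℝ, 0 < ε → (∀ (n : ℕ) (Q : Fin n → Quad (Set.univ : Set ℂ)) (g : Set (Fin n) → ℝ) (φ : ℂ → ℝ), Continuous φ → HasCompactSupport φ → ∫ S, ∫ x, φ x * g {i | Q i ∈ S} ∂(M ε S) ∂(P₁) = ∫ S, ∫ x, φ x * g {i | Xor (Q i ∈ S) (Piv S x (Q i))} ∂(M ε S) ∂(P₁))) → (∀ ε : ℝ, 0 < ε → (∀ (n : ℕ) (Q : Fin n → Quad (Set.univ : Set ℂ)) (g : Set (Fin n) → ℝ) (φ : ℂ → ℝ), Continuous φ → HasCompactSupport φ → ∫ S, ∫ x, φ x * g {i | Q i ∈ S} ∂(M ε S) ∂(P₂) = ∫ S, ∫ x, φ x * g {i | Xor (Q i ∈ S) (Piv S x (Q i))} ∂(M ε S) ∂(P₂))) → P₁ + P₂ = ((μ : MeasureTheory.FiniteMeasure (QuadConfig (Set.univ : Set ℂ))) : MeasureTheory.Measure (QuadConfig (Set.univ : Set ℂ))) + ((μ : MeasureTheory.FiniteMeasure (QuadConfig (Set.univ : Set ℂ))) : MeasureTheory.Measure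 (QuadConfig (Set.univ : Set ℂ))) → P₁ = ((μ : MeasureTheory.FiniteMeasure (QuadConfig (Set.univ : Set ℂ))) : MeasureTheory.Measure (QuadConfig (Set.univ : Set ℂ))))

/-- item stmt-CriticalPhenomena-14826 · crux · rank 4 · open · by planner
why it might fail: Contains universality (critical Voronoi / any self-dual isotropic lattice limit meets every hypothesis given K1/K3-type inputs) and an exotic self-dual flip-fair flip-ergodic E(2)-law on ℋ may exist; the uniqueness-of-stationary-law proof needs a flip-dynamics coupling nobody has.
sources: GarbanPeteSchramm2018, GarbanPeteSchramm2013Pivotal, SchrammSmirnov2011, LastPenrose2017, arXiv:1706.07602, Tsirelson2003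
[crux] MECKE RIGIDITY (card K2, conclusion on the LAW's crossing values only, per triage flag): let
P be a probability law on ℋ_ℂ = QuadConfig univ and M : ℝ → ℋ_ℂ → Measure ℂ a kernel family (cutoff
ε ↦ M_ε) such that (E2) P is invariant under every isometry of ℂ; (D) P is exactly self-dual on
finite-dimensional crossing marginals (law of (Q_i ∈ S)_i = law of (Q_iᵗ ∉ S)_i, Q_iᵗ the transposed
quads); (RSW) every quad whose carrier is an axis-parallel 3:1 rectangle with sides 0/2 its short
edges has crossing probability ≥ c > 0; (ADM) each M_ε is measurable in S, monotone in ε, locally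
P-integrable, supported on pivotal points, non-zero, isometry-equivariant; (F) for every ε > 0 the
Campbell measure P(dS)M_ε(S)(dx) is invariant under the pivotal involution on cylinder test
functions φ(x)·g({i | Q_i ∈ S}) ↦ φ(x)·g({i | Q_i ∈ S} Δ {i | Piv S x Q_i}); (EXT) P is a
midpoint-extreme point of the convex set of probability laws flip-fair for every M_ε (=
flip-ergodicity). THEN every quad of a conformal rectangle has P-probability F(cross-ratio).
[difficulty: open-problem] -/
@[route_item "route-CriticalPhenomena-CardyMeckeFlip", crux]
def MeckeRigidity : Prop :=
  open Literature.Probability.Percolation.QuadCrossing in ∀ (Piv : QuadConfig (Set.univ : Set ℂ) → ℂ → Quad (Set.univ : Set ℂ) → Prop), (∀ (S : QuadConfig (Set.univ : Set ℂ)) (x : ℂ) (Q : Quad (Set.univ : Set ℂ)), Piv S x Q ↔ ((Q ∈ S ∧ ∀ ε : ℝ, 0 < ε → ∀ Q' : Quad (Set.univ : Set ℂ), Q'.carrier ⊆ Q.carrier \ Metric.ball x ε → Q'.side 0 ⊆ Q.side 0 → Q'.side 2 ⊆ Q.side 2 → Q' ∉ S) ∨ (Q ∉ S ∧ ∀ ε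 : ℝ, 0 < ε → ∃ Q₁ Q₂ : Quad (Set.univ : Set ℂ), Q₁ ∈ S ∧ Q₂ ∈ S ∧ Q₁.carrier ⊆ Q.carrier ∧ Q₂.carrier ⊆ Q.carrier ∧ Q₁.side 0 ⊆ Q.side 0 ∧ Q₁.side 2 ⊆ Metric.ball x ε ∧ Q₂.side 0 ⊆ Metric.ball x ε ∧ Q₂.side 2 ⊆ Q.side 2))) → ∀ (P : MeasureTheory.Measure (QuadConfig (Set.univ : Set ℂ))) (M : ℝ → QuadConfig (Set.univ : Set ℂ) → MeasureTheory.Measure ℂ), MeasureTheory.IsProbabilityMeasure P → (∀ g : ℂ ≃ᵢ ℂ, MeasureTheory.Measure.map (QuadConfig.isometry g) (P) = P) → (∀ (n : ℕ) (Q Qt : Fin n → Quad (Set.univ : Set ℂ)), (∀ i, (Qt i).carrier = (Q i).carrier ∧ (Qt i).side 0 = (Q i).side 1 ∧ (Qt i).side 1 = (Q i).side 2 ∧ (Qt i).side 2 = (Q i).side 3 ∧ (Qt i).side 3 = (Q i).side 0) → ∀ A : Set (Set (Fin n)), (P) {S | {i | Q i ∈ S} ∈ A} = (P) {S | {i | Qt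 i ∉ S} ∈ A}) → ∀ c : ℝ, 0 < c → (∀ (a x y : ℝ), 0 < a → ∀ Q : Quad (Set.univ : Set ℂ), Q.carrier = {w : ℂ | x ≤ w.re ∧ w.re ≤ x + 3 * a ∧ y ≤ w.im ∧ w.im ≤ y + a} → Q.side 0 = {w : ℂ | w.re = x ∧ y ≤ w.im ∧ w.im ≤ y + a} → Q.side 2 = {w : ℂ | w.re = x + 3 * a ∧ y ≤ w.im ∧ w.im ≤ y + a} → c ≤ (P).real (QuadConfig.crossedEvent Q)) → ((∀ ε : ℝ, Measurable (M ε)) ∧ (∀ ε ε' : ℝ, 0 < ε' → ε' ≤ ε → ∀ S : QuadConfig (Set.univ : Set ℂ), M ε S ≤ M ε' S) ∧ (∀ ε : ℝ, 0 < ε → ∀ r : ℝ, ∫⁻ S, M ε S (Metric.closedBall 0 r) ∂(P) < ⊤) ∧ (∀ ε : ℝ, 0 < ε → ∀ᵐ S ∂(P), M ε S {x | ¬ ∃ Q : Quad (Set.univ : Set ℂ), Piv S x Q} = 0) ∧ (∃ ε : ℝ, 0 < ε ∧ 0 < ∫⁻ S, M ε S (Metric.ball 0 1) ∂(P)) ∧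 (∀ (g : ℂ ≃ᵢ ℂ) (ε : ℝ) (S : QuadConfig (Set.univ : Set ℂ)), M ε (QuadConfig.isometry g S) = MeasureTheory.Measure.map g (M ε S))) → (∀ ε : ℝ, 0 < ε → (∀ (n : ℕ) (Q : Fin n → Quad (Set.univ : Set ℂ)) (g : Set (Fin n) → ℝ) (φ : ℂ → ℝ), Continuous φ → HasCompactSupport φ → ∫ S, ∫ x, φ x * g {i | Q i ∈ S} ∂(M ε S) ∂(P) = ∫ S, ∫ x, φ x * g {i | Xor (Q i ∈ S) (Piv S x (Q i))} ∂(M ε S) ∂(P))) → (∀ P₁ P₂ : MeasureTheory.Measure (QuadConfig (Set.univ : Set ℂ)), MeasureTheory.IsProbabilityMeasure P₁ → MeasureTheory.IsProbabilityMeasure P₂ → (∀ ε : ℝ, 0 < ε → (∀ (n : ℕ) (Q : Fin n → Quad (Set.univ : Set ℂ)) (g : Set (Fin n) → ℝ) (φ : ℂ → ℝ), Continuous φ → HasCompactSupport φ → ∫ S, ∫ x, φ x * g {i | Q i ∈ S} ∂(M ε S) ∂(P₁) = ∫ S, ∫ x, φ x * g {i | Xor (Q i ∈ S) (Piv S x (Q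 i))} ∂(M ε S) ∂(P₁))) → (∀ ε : ℝ, 0 < ε → (∀ (n : ℕ) (Q : Fin n → Quad (Set.univ : Set ℂ)) (g : Set (Fin n) → ℝ) (φ : ℂ → ℝ), Continuous φ → HasCompactSupport φ → ∫ S, ∫ x, φ x * g {i | Q i ∈ S} ∂(M ε S) ∂(P₂) = ∫ S, ∫ x, φ x * g {i | Xor (Q i ∈ S) (Piv S x (Q i))} ∂(M ε S) ∂(P₂))) → P₁ + P₂ = P + P → P₁ = P) → (∀ (R : Literature.Probability.RandomPlanarGeometry.ConformalRectangle) (φ : Literature.Probability.RandomPlanarGeometry.ConformalEquiv UpperHalfPlane.upperHalfPlaneSet R.carrier) (x : Fin 4 → ℝ), R.IsUniformizing φ x → ∀ Q : Quad (Set.univ : Set ℂ), Q.carrier = closure R.carrier → Q.side 0 = R.arc 0 → Q.side 1 = R.arc 1 → Q.side 2 = R.arc 2 → Q.side 3 = R.arc 3 → (P).real (QuadConfig.crossedEvent Q) = Literature.Probability.RandomPlanarGeometry.cardyFunction (Literature.Probability.RandomPlanarGeometry.crossRatio x))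

/-- item stmt-CriticalPhenomena-14827 · crux · rank 5 · open · by planner
why it might fail: Joint rotation invariance of the LAW on ℋ needs DKKMO's loop theorem + loops→quads measurability (in tree only the per-quad fact dkkmo_crossing_rotation_invariance, unproved); exact self-duality for ALL quads needs null frontier of every fixed quad (SS11 Cor 5.2, ℤ² 3-arm inputs).
sources: DKKMO2020Rotational, SchrammSmirnov2011, GarbanPeteSchramm2013Pivotal, GrimmettPercolation1999, Tassion2016
[crux] SYMMETRIES OF ℤ² SUBLIMITS (the non-flip hypotheses of MeckeRigidity): every μ ∈
subseqQuadLimits univ is a probability law, invariant under every isometry of ℂ (translations: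
lattice + continuity; rotations: DKKMO; reflections: lattice), exactly self-dual on
finite-dimensional crossing marginals (lattice duality at p = ½ + null boundary events), and
satisfies the 3:1 RSW lower bound with some c > 0 (rsw_half + null frontier). [difficulty: L] -/
@[route_item "route-CriticalPhenomena-CardyMeckeFlip", crux]
def Z2LimitsSymmetric : Prop :=
  open Literature.Probability.Percolation.QuadCrossing in ∀ μ : MeasureTheory.FiniteMeasure (QuadConfig (Set.univ : Set ℂ)), μ ∈ subseqQuadLimits (Set.univ : Set ℂ) → MeasureTheory.IsProbabilityMeasure ((μ : MeasureTheory.FiniteMeasure (QuadConfig (Set.univ : Set ℂ))) : MeasureTheory.Measure (QuadConfig (Set.univ : Set ℂ))) ∧ (∀ g : ℂ ≃ᵢ ℂ, MeasureTheory.Measure.map (QuadConfig.isometry g) (((μ : MeasureTheory.FiniteMeasure (QuadConfig (Set.univ : Set ℂ))) : MeasureTheory.Measure (QuadConfig (Set.univ : Set ℂ)))) = ((μ : MeasureTheory.FiniteMeasure (QuadConfig (Set.univ : Set ℂ))) : MeasureTheory.Measure (QuadConfig (Set.univ : Set ℂ)))) ∧ (∀ (n : ℕ) (Q Qt : Fin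 n → Quad (Set.univ : Set ℂ)), (∀ i, (Qt i).carrier = (Q i).carrier ∧ (Qt i).side 0 = (Q i).side 1 ∧ (Qt i).side 1 = (Q i).side 2 ∧ (Qt i).side 2 = (Q i).side 3 ∧ (Qt i).side 3 = (Q i).side 0) → ∀ A : Set (Set (Fin n)), (((μ : MeasureTheory.FiniteMeasure (QuadConfig (Set.univ : Set ℂ))) : MeasureTheory.Measure (QuadConfig (Set.univ : Set ℂ)))) {S | {i | Q i ∈ S} ∈ A} = (((μ : MeasureTheory.FiniteMeasure (QuadConfig (Set.univ : Set ℂ))) : MeasureTheory.Measure (QuadConfig (Set.univ : Set ℂ)))) {S | {i | Qt i ∉ S} ∈ A}) ∧ ∃ c : ℝ, 0 < c ∧ (∀ (a x y : ℝ), 0 < a → ∀ Q : Quad (Set.univ : Set ℂ), Q.carrier = {w : ℂ | x ≤ w.re ∧ w.re ≤ x + 3 * a ∧ y ≤ w.im ∧ w.im ≤ y + a} → Q.side 0 = {w : ℂ | w.re = x ∧ y ≤ w.im ∧ w.im ≤ y + a} → Q.side 2 = {w : ℂ | w.re = x + 3 * a ∧ y ≤ w.im ∧ w.im ≤ y + a}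 → c ≤ (((μ : MeasureTheory.FiniteMeasure (QuadConfig (Set.univ : Set ℂ))) : MeasureTheory.Measure (QuadConfig (Set.univ : Set ℂ)))).real (QuadConfig.crossedEvent Q))

-- earlier LatticeFlipIdentity (stmt-CriticalPhenomena-14829, replaced 2026-08-15T20:08:13Z -> stmt-CriticalPhenomena-13896): retired by None — ∀ (δ : ℝ), 0 < δ → ∀ (E : Finset (Sym2 (Literature.Probability.LatticeModels.Site 2))), (∀ e ∈ E, e ∈ (Literature.Probability.LatticeModels.zdGraph 2).edgeSet) → ∀ (n : ℕ) (Q : Fin n → Literature.Probability.Percolation.QuadCrossing.Quad (Set.univ : Set ℂ)) (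
/-- item stmt-CriticalPhenomena-13896 · support · rank 9 · closed · proved by Summit.CriticalPhenomena.CardyFormulaZ2.Theorems.CardyMeckeFlip.latticeFlipIdentity_proof (prover) · by planner
sources: GrimmettPercolation1999, GarbanPeteSchramm2018, Mecke1967
[support] THE EXACT LATTICE MECKE IDENTITY (card P1, provable now): for bond percolation on δℤ² at p
= ½, every finite set E of lattice edges, every finite family of quads Q_i and every bounded
measurable h(ω, e): Σ_{e∈E} E[1{e pivotal for some Q_i}·h(ω^e, e)] = Σ_{e∈E} E[1{e pivotal for some
Q_i}·h(ω, e)], where ω^e = ω Δ {e} and "pivotal" = the crossing status of Q_i in ω_δ differs between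
ω and ω^e. Proof: ω ↦ ω Δ {e} preserves P_½ for a genuine edge e and pivotality of e is symmetric
under it. (At general p the defect is (1−2p)·Σ_e E[1{piv}·h·(1{e open}/p − 1{e closed}/(1−p))]: the
identity characterises p = ½.) TYPING (cone repair 2026-08-15, rrepair-cc7ec255): ω_δ is written as
`QuadCrossing.configOf Site.toComplex δ univ (ω ∩ (zdGraph 2).edgeSet)` — the definitional unfolding
of `z2QuadConfig univ δ ω` (New ↔ Old by Iff.rfl) — so that the route file imports only
Literature.Probability.Percolation.QuadCrossingSpace; PROVERS: do NOT import QuadCrossingSpaceZ2 /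
QuadCrossingRotationInvariance(Proofs) in the Theorems file (they carry the unproved XL fact
dkkmo_crossing_rotation_invariance into this route's module cone and re-block it under the Phase-C
guardrail); BondPercolation -/
@[route_item "route-CriticalPhenomena-CardyMeckeFlip"]
def LatticeFlipIdentity : Prop :=
  open Literature.Probability.Percolation.QuadCrossing in ∀ (δ : ℝ), 0 < δ → ∀ (E : Finset (Sym2 (Literature.Probability.LatticeModels.Site 2))), (∀ e ∈ E, e ∈ (Literature.Probability.LatticeModels.zdGraph 2).edgeSet) → ∀ (n : ℕ) (Q : Fin n → Quad (Set.univ : Set ℂ)) (h : Literature.Probability.Percolation.BondConfig (Literature.Probability.LatticeModels.Site 2) → Sym2 (Literature.Probability.LatticeModels.Site 2) → ℝ), (∀ e, Measurable (fun ω => h ω e)) → (∃ C : ℝ, ∀ ω e, |h ω e| ≤ C) → ∑ e ∈ E, ∫ ω, (if ∃ i, ¬ (Q i ∈ configOf Literature.Probability.LatticeModels.Site.toComplex δ (Set.univ : Set ℂ) (ω ∩ (Literature.Probability.LatticeModels.zdGraph 2).edgeSet) ↔ Q i ∈ configOf Literature.Probability.LatticeModels.Site.toComplex δ (Set.univ :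 Set ℂ) (symmDiff ω {e} ∩ (Literature.Probability.LatticeModels.zdGraph 2).edgeSet)) then h (symmDiff ω {e}) e else 0) ∂(Literature.Probability.Percolation.bondPercolation (Literature.Probability.LatticeModels.zdGraph 2) Literature.Probability.Percolation.half) = ∑ e ∈ E, ∫ ω, (if ∃ i, ¬ (Q i ∈ configOf Literature.Probability.LatticeModels.Site.toComplex δ (Set.univ : Set ℂ) (ω ∩ (Literature.Probability.LatticeModels.zdGraph 2).edgeSet) ↔ Q i ∈ configOf Literature.Probability.LatticeModels.Site.toComplex δ (Set.univ : Set ℂ) (symmDiff ω {e} ∩ (Literature.Probability.LatticeModels.zdGraph 2).edgeSet)) then h ω e else 0) ∂(Literature.Probability.Percolation.bondPercolation (Literature.Probability.LatticeModels.zdGraph 2) Literature.Probability.Percolation.half)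

/-- item stmt-CriticalPhenomena-14160 · support · rank 9 · closed · proved by Summit.CriticalPhenomena.CardyFormulaZ2.Theorems.cardyMeckeFlip_cruxesToSublimitsCardy (prover) · by planner
sources: SchrammSmirnov2011, GarbanPeteSchramm2018
[support] GLUE — TARGET REACHABILITY (route-choice 2026-08-16, option (a) `Crux… → SublimitsCardy`):
the three law-level cruxes imply the target: MeckeRigidity → FlipErgodicityZ2 → Z2LimitsSymmetric →
SublimitsCardy. Proof (pure logic, provable now): for μ ∈ subseqQuadLimits univ take (prob, E2, D,
c, RSW) from Z2LimitsSymmetric, the admissible flip-fair extremal kernel family M from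
FlipErgodicityZ2 instantiated at Piv := its defining predicate (`fun _ _ _ => Iff.rfl`), and apply
MeckeRigidity at the same Piv to (μ, M) — literally the first `have` of the deciding theorem
`closes` (planner Sketch.lean: `intro hK2 hK3 hS μ hμ; obtain ⟨hprob, hsym, hdual, c, hc, hrsw⟩ :=
hS μ hμ; obtain ⟨M, hadm, hff, hext⟩ := hK3 _ (fun _ _ _ => Iff.rfl) μ hμ; exact hK2 _ (fun _ _ _ =>
Iff.rfl) _ M hprob hsym hdual c hc hrsw hadm hff hext`, lean rc 0, axioms
propext/Classical.choice/Quot.sound). This is the item that CONCLUDES the target, so the item graph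
reads cruxes → SublimitsCardy → (LawToCrossings, closes) CardyFormulaZ2; `closes` itself is
unchanged. [deps: MeckeRigidity, FlipErgodicityZ2, Z2LimitsSymmetric] [difficulty: provable-now] -/
@[route_item "route-CriticalPhenomena-CardyMeckeFlip"]
def CruxesToSublimitsCardy : Prop :=
  MeckeRigidity → FlipErgodicityZ2 → Z2LimitsSymmetric → SublimitsCardy

/-- item stmt-CriticalPhenomena-14828 · support · rank 9 · closed · proved by Summit.CriticalPhenomena.CardyFormulaZ2.Theorems.lawToCrossings_proof (prover) · by planner
sources: SchrammSmirnov2011, GarbanPeteSchramm2013Pivotal, GrimmettPercolation1999, Smirnov2001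
[support] BRIDGE (card P2): SublimitsCardy ⇒ for every mesh sequence u_k → 0⁺ there is a subsequence
ψ along which bondDomainCrossingProb R (u (ψ k)) → F(crossRatio x) for every conformal rectangle R
and uniformizing datum. Proof path: SchrammSmirnov2011_thm_1_4_holds (compact metrisable ℋ_ℂ, PROVED
in tree) + Prokhorov extract μ ∈ Λ along a sub-subsequence of z2QuadLaw univ (u (ψ k)); null
frontier of ⊞_Q under percolation sublimits (SS11 Cor 5.2; QuadCrossingNullFrontier) + portmanteau
give convergence of μ_δ(⊞_Q); quadCrossing_subset_setOf_mem_z2QuadConfig /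
setOf_mem_z2QuadConfig_subset_quadCrossing pass to the continuum-arc event 𝒞_δ(R); boundary RSW
passes to G02's discrete-arc event (content of the shared DiscretisationBridge
stmt-CriticalPhenomena-0787). [difficulty: L] -/
@[route_item "route-CriticalPhenomena-CardyMeckeFlip", crux]
def LawToCrossings : Prop :=
  SublimitsCardy → ∀ u : ℕ → ℝ, Filter.Tendsto u Filter.atTop (nhdsWithin (0 : ℝ) (Set.Ioi 0)) → ∃ ψ : ℕ → ℕ, StrictMono ψ ∧ ∀ (R : Literature.Probability.RandomPlanarGeometry.ConformalRectangle) (φ : Literature.Probability.RandomPlanarGeometry.ConformalEquiv UpperHalfPlane.upperHalfPlaneSet R.carrier) (x : Fin 4 → ℝ), R.IsUniformizing φ x → Filter.Tendsto (fun k => Literature.Probability.Percolation.bondDomainCrossingProb R (u (ψ k))) Filter.atTop (nhds (Literature.Probability.RandomPlanarGeometry.cardyFunction (Literature.Probability.RandomPlanarGeometry.crossRatio x)))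

/-- item stmt-CriticalPhenomena-14830 · assembly · rank 1 · closed · proved by Summit.CriticalPhenomena.CardyFormulaZ2.Theorems.cardyMeckeFlip_assembly_proof (prover) · by planner
sources: SchrammSmirnov2011, GarbanPeteSchramm2018, Smirnov2001
[assembly] MeckeRigidity → FlipErgodicityZ2 → Z2LimitsSymmetric → LawToCrossings → CardyFormulaZ2
(literally the deciding theorem `closes`). -/
@[route_item "route-CriticalPhenomena-CardyMeckeFlip"]
def Assembly : Prop :=
  MeckeRigidity → FlipErgodicityZ2 → Z2LimitsSymmetric → LawToCrossings → _root_.CardyFormulaZ2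

/-! D-0027 §2.1 — DECIDING THEOREM (planner-authored via `route open/edit --closes-file`; by planner-rrepair-CriticalPhenomena-CardyMeckeFl-cc7ec255-0 2026-08-15T20:08:13Z):
its hypotheses are this route's items and its conclusion the sub-problem Statement (glue_lint), and it elaborates with this file. -/

@[closes "route-CriticalPhenomena-CardyMeckeFlip"] theorem closes (hK2 : MeckeRigidity) (hK3 : FlipErgodicityZ2) (hS : Z2LimitsSymmetric)
    (hB : LawToCrossings) : _root_.CardyFormulaZ2 := by
  -- layer 2 → layer 1 (law level): every subsequential quad-crossing limit of bond-ℤ² has Cardy values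
  have hT : SublimitsCardy := by
    intro μ hμ
    obtain ⟨hprob, hsym, hdual, c, hc, hrsw⟩ := hS μ hμ
    -- `Piv := its defining predicate` is found by unification from `Iff.rfl`
    obtain ⟨M, hadm, hff, hext⟩ := hK3 _ (fun _ _ _ => Iff.rfl) μ hμ
    exact hK2 _ (fun _ _ _ => Iff.rfl) _ M hprob hsym hdual c hc hrsw hadm hff hext
  -- layer 1 → Statement: `𝓝[>] 0` is countably generated, so convergence follows from
  -- convergence along a subsequence of every mesh sequence (LimitExists is OUTPUT).
  intro R φ x hφx
  refine Filter.tendsto_of_subseq_tendsto fun u hu => ?_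
  obtain ⟨ψ, -, hconv⟩ := hB hT u hu
  exact ⟨ψ, hconv R φ x hφx⟩

end Summit.CriticalPhenomena.CardyFormulaZ2.Theses.CardyMeckeFlip
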